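import Summits.Parity.GeneralizedHardyLittlewood.Theorems.DicksonFibrationDimOnePerimeter
import HarnessLib

/-! # Crux `DimOne` (stmt-Parity-0819; route `DicksonFibration`, rank 2) — SKELETON of line `birth`
# (sieve model), v5: ONE open stub, narrowed to its open core (lead `prover-line-stmt-Parity-0819-c3-0`, 2026-08-17)

Target: the route decl `Summit.Parity.GeneralizedHardyLittlewood.Theses.DicksonFibration.DimOne` BY NAME.

State of the line. The splitting `Λ = Λ♯_N + Λ♭_N` along a `d = 1` system with the sieve model
`Λ♯_N = 1[·>0] Λ_{ℤ/P_N}`, `P_N = ∏_{p ≤ N^{1/⌈√log N⌉}} p` (vocabulary `Theorems/DicksonFibrationDimOneDefs.lean`),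
expanded multilinearly by the set `T` of rough positions (`vonMangoldtSum = Σ_T corrTerm T`), is carried out IN THE
TREE (lead c2): `stub_sieveCount` p151176, `stub_singularTail` p152000, `stub_primeClassSums` p153261,
`stub_primeSieve` p158126, `sharpMainTerm` (S♯) / `oneFlatFactor` (S1) p158590, and the exact reduction
`twoFlatFactors_iff_dimOne : TwoFlatFactors ↔ DimOne` p158809.

v4/v5 (lead c3) PEELS THE PROVABLE PERIMETER off the one open stub `TwoFlatFactors` (S2) — landed as
`Theorems/DicksonFibrationDimOnePerimeter.lean` (p160961):
* `t ≤ 1`: the `#T ≥ 2` sum is empty (`sum_twoFlat_eq_zero`); with S♯, S1 the `t = 1` slice of the crux is now an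
  unconditional theorem (`dimOne_one`: PNT in progressions mod `a ≤ L`, uniform in shifts `≤ LN`);
* LOCALLY OBSTRUCTED systems (`β_p(Ψ) = 0` at some prime: `(n, n+1)`, `(n, n+2, n+4)`, non-primitive forms): `𝔖 = 0`
  and `Σ_K ∏Λ(ψ_i n) = O_{t,L}(log^{t+1} N)` (`dimOne_of_localFactor_eq_zero`, `twoFlatFactors_of_localFactor_eq_zero`);
* composition `twoFlatFactors_of_core'`: S2 follows from its restriction to `t ≥ 2` and `β_p(Ψ) > 0` at every prime.

So the ONE registered stub below is S2 ON ITS OPEN CORE: `t ≥ 2`, no local obstruction (`⟺ 𝔖(Ψ) > 0`) — literally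
the admissible Dickson–Hardy–Littlewood prime `t`-tuple conjecture (Λ-weighted, shift-uniform) in rough-vs-rough
form. It is OPEN for every `t ≥ 2`; every catalogued binary barrier bites here and only here
(Literature.Barriers.Parity.SelbergParityBarrier, .SiegelZeroPrimePairBarrier — `twoFlatFactors_false_of_unboundedSiegelZeros`
mod Matomäki–Merikoski —, .CircleMethodBinaryBarrier, .TrueComplexityBinary / CriticalDensityHalf). The stub statement
is the named `TwoFlatFactorsCore` of the vocabulary file (p161171; unfolding `twoFlatFactorsCore_iff`); its exact position
`TwoFlatFactorsCore ↔ DimOne ↔ GeneralizedHardyLittlewood` is `Theorems/DicksonFibrationDimOneCore.lean`.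
-/

noncomputable section

namespace Summit.Parity.GeneralizedHardyLittlewood.Cruxes.DimOne.BirthSieve

open scoped BigOperators Classical
open Finset Literature.NumberTheory.Sieve

/-! ## Registered stub (the ONLY `sorry` of this file) -/

/-- Registered stub S2-CORE — AT LEAST TWO ROUGH FACTORS, ADMISSIBLE SYSTEMS, `t ≥ 2` (the load-bearing, open,
parity-sensitive statement): `|Σ_{T ⊆ [t], #T ≥ 2} corrTerm T Ψ K N| ≤ ε N` uniformly over non-degenerate `d = 1`
systems of `t ≥ 2` forms with `‖Ψ‖_N ≤ L` and `β_p(Ψ) > 0` at every prime, and convex `K ⊆ [−N, N]`.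
(Implies the crux via `twoFlatFactors_of_core'` and `dimOne_of_twoFlatFactors`, and is implied by it: `core_iff_dimOne`.) -/
theorem stub_twoFlatFactorsCore : TwoFlatFactorsCore := by
  sorry

/-! ## The composition: the stub implies the crux, by name -/

/-- **THE SKELETON THEOREM.** The core stub implies
`Summit.Parity.GeneralizedHardyLittlewood.Theses.DicksonFibration.DimOne`: peel `t ≤ 1` and the locally
obstructed systems (`twoFlatFactors_of_core'`, landed), then S♯ + S1 + S2 (`dimOne_of_twoFlatFactors`, landed).
[folklore] -/
theorem DimOne_of_stub :
    TwoFlatFactorsCore → Summit.Parity.GeneralizedHardyLittlewood.Theses.DicksonFibration.DimOne :=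
  fun h => dimOne_of_twoFlatFactors (twoFlatFactors_of_core' h)

/-- The skeleton in its final shape: the crux BY NAME from the one registered stub (it depends on `sorryAx`
only through `stub_twoFlatFactorsCore`). [folklore] -/
theorem DimOne_proof : Summit.Parity.GeneralizedHardyLittlewood.Theses.DicksonFibration.DimOne :=
  DimOne_of_stub stub_twoFlatFactorsCore

end Summit.Parity.GeneralizedHardyLittlewood.Cruxes.DimOne.BirthSieve

end
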